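import Summits.HodgeConjecture.HodgeConjecture.Theses.RankFourFaces
import Summits.HodgeConjecture.CorCM.RankFourCMProductCMType
import HarnessLib

/-!
# Route `RankFourFaces`, crux `FaceReduction` (stmt-HodgeConjecture-16266), line `birth`:
# stub B1 `stub_andreReduction` — André's reduction `B^∞ ⟹ CMAbelianHodge`

HONEST FRAMING (prover, cell pub-hodgecm2 / COR-CM seat b24 gen 21; theorem only, no definition, no named fact; no case
of the Hodge conjecture is proved — the implication is).  The registered stub
`stub_andreReduction : CMProductWeilClassesAlgebraic → RankFourFaces.CMAbelianHodge` of the skeleton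
`Summits/HodgeConjecture/HodgeConjecture/Cruxes/FaceReduction/Lines/birth.lean` (sha 907f1396fc06): if the rational
`(k,k)` E-Weil classes of all E-CM `2k`-products of Weil type are algebraic (all CM polynomials `P` of degree `2g`,
`g ≥ 1`, `k ≥ 1`), then the Hodge conjecture holds for every complex abelian variety of CM type (the route decl
`CMAbelianHodge`, BY NAME).  The hypothesis is restated VERBATIM as a local notation (its `def` lives in the crux workfile, which a Theorems file may
not import), so the theorem carries the registered signature token for token.

PROOF: only the instance `k = 2` is used (`CorCM.RankFourWeil.rankFourCMProductWeilClassesAlgebraic_of_cmProductWeilClassesAlgebraic`,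
`B^∞ ⟹ B⁴`), and `B⁴ ⟹ HC_CM = CMAbelianHodge` (`CorCM.RankFourWeil.hc_cm_of_rankFourCMProductWeilClassesAlgebraic`):
the CM corner products of the rank-four faces of the Galois CM fields of degree `≥ 6` are E-CM 4-products of Weil type
whose `W_F ⊗ ℂ` is the face Weil-line space (Moonen–Zarhin), so `B⁴` gives `W_RK4` on the model universe of cell
pub-hodgecm2, and `W_RK4 ⟹ HC_CM` ([QW8] face reduction on the model; exhaustion of the CM sector by Galois slices via
André's product form, Pohlmann, Deligne–Milne: `CorCM.SliceExhaustion.hc_cm_of_w_rk4`).  André's theorem in the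
geometric form the line card cites (Charles–Schnell Thm. 11.5.21 = Markman Thm. 1.4) is thus realised on the tree's
carriers through the cell's André product form rather than cited.

References: [Andre1992HodgeCM] Y. André, Progr. Math. 102 (1992), Théorème; [CharlesSchnell2014Notes] Thm. 11.5.21,
Prop. 11.5.22; [Markman2025SurveySecant] arXiv:2509.23403 Thm. 1.4; [Pohlmann1968] Thm. 1;
[MoonenZarhin1998WeilClasses] §1; [Milne1999] §2 p. 54, §7 p. 72.
-/

set_option linter.dupNamespace false

open CategoryTheory

namespace Summit.HodgeConjecture.HodgeConjecture.Theorems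

/-- `CMProductWeilClassesAlgebraic` — statement `B^∞` of the crux line, LOCAL NOTATION ONLY, expanding to the VERBATIM body
of the `def CMProductWeilClassesAlgebraic : Prop` of `Cruxes/FaceReduction/Lines/birth.lean` (skeleton 907f1396fc06):
rational `(k,k)` E-Weil classes on E-CM `2k`-products of Weil type are algebraic, every `k ≥ 1`, every CM polynomial `P`
of degree `2g`, `g ≥ 1`. [cite: Andre1992HodgeCM, Théorème] [cite: CharlesSchnell2014Notes, Lemma 11.5.18] -/
local notation3 (prettyPrint := false) "CMProductWeilClassesAlgebraic" =>
  (∀ (g : ℕ), 1 ≤ g → ∀ (P : Polynomial ℤ), P.Monic → P.natDegree = 2 * g →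
    Irreducible (P.map (Int.castRingHom ℚ)) →
    (∀ ρ : ℂ, Polynomial.eval₂ (Int.castRingHom ℂ) ρ P = 0 → ρ.im ≠ 0) →
    (∃ Q : Polynomial ℚ, ∀ ρ : ℂ, Polynomial.eval₂ (Int.castRingHom ℂ) ρ P = 0 →
    Polynomial.aeval ρ Q = (starRingEnd ℂ) ρ) →
    ∀ (k : ℕ), 1 ≤ k →
    ∀ (B : Fin (2 * k) → Literature.AlgebraicGeometry.Motives.AbelianVariety ℂ) (ψ : ∀ i, B i ⟶ B i),
    (∀ i, (B i).dim = g) →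
    (∀ i, Polynomial.eval₂ (Int.castRingHom (CategoryTheory.End (B i)))
    (ψ i : CategoryTheory.End (B i)) P = 0) →
    ∀ (Y : Literature.AlgebraicGeometry.Motives.AbelianVariety ℂ) (φ : Y ⟶ Y) (π : ∀ i, Y ⟶ B i),
    (∀ i, π i ≫ ψ i = φ ≫ π i) →
    Nonempty (CategoryTheory.Limits.IsLimit (CategoryTheory.Limits.Fan.mk Y π)) →
    Y.dim = 2 * k * g →
    Literature.AlgebraicGeometry.Motives.IsSmoothProjective (2 * k * g) Y.X →
    Polynomial.eval₂ (Int.castRingHom (CategoryTheory.End Y)) (φ : CategoryTheory.End Y) P = 0 →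
    (∀ c ∈ (⨆ ρ ∈ {ρ : ℂ | Polynomial.eval₂ (Int.castRingHom ℂ) ρ P = 0},
    Literature.AlgebraicGeometry.HodgeTheory.pullbackEigenclasses Y φ (2 * k)
    (fun x y => ((x : ℂ) + (y : ℂ) * ρ) ^ (2 * k))),
    Literature.AlgebraicGeometry.HodgeTheory.IsOfHodgeType (2 * k * g) Y.X (2 * k) k k c) →
    ∀ c : Literature.AlgebraicGeometry.HodgeTheory.complexBetti Y.X (2 * k),
    Literature.AlgebraicGeometry.HodgeTheory.IsRationalClass c →
    Literature.AlgebraicGeometry.HodgeTheory.IsOfHodgeType (2 * k * g) Y.X (2 * k) k k c →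
    c ∈ (⨆ ρ ∈ {ρ : ℂ | Polynomial.eval₂ (Int.castRingHom ℂ) ρ P = 0},
    Literature.AlgebraicGeometry.HodgeTheory.pullbackEigenclasses Y φ (2 * k)
    (fun x y => ((x : ℂ) + (y : ℂ) * ρ) ^ (2 * k))) →
    c ∈ Literature.AlgebraicGeometry.HodgeTheory.algebraicClasses Y.X k)

/-- **Stub B1 of the line `birth` — André's reduction `B^∞ ⟹ CMAbelianHodge`** (registered signature
`CMProductWeilClassesAlgebraic → Summit.HodgeConjecture.HodgeConjecture.Theses.RankFourFaces.CMAbelianHodge`, hypothesis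
token for token via the local notation above; conclusion the route decl by name): algebraicity of the rational `(k,k)` E-Weil classes on all E-CM
`2k`-products of Weil type implies the Hodge conjecture for every complex abelian variety of CM type.  Proof:
`B^∞ ⟹ B⁴ ⟹ HC_CM`. [cite: Andre1992HodgeCM, Théorème] [cite: CharlesSchnell2014Notes, Thm. 11.5.21 and Prop. 11.5.22]
[cite: Pohlmann1968, Thm. 1] -/
theorem stub_andreReduction :
    CMProductWeilClassesAlgebraic → Summit.HodgeConjecture.HodgeConjecture.Theses.RankFourFaces.CMAbelianHodge :=
  fun h => Summit.HodgeConjecture.CorCM.RankFourWeil.hc_cm_of_rankFourCMProductWeilClassesAlgebraic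
    (Summit.HodgeConjecture.CorCM.RankFourWeil.rankFourCMProductWeilClassesAlgebraic_of_cmProductWeilClassesAlgebraic h)

end Summit.HodgeConjecture.HodgeConjecture.Theorems
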